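import Summits.QuantumFields.YangMills.Theorems.BalabanLadderUVSeamRecSeparatedFamilyColouring
import Summits.QuantumFields.YangMills.Theorems.BalabanLadderUVSeamRecResponseMomentsRecentring
import Mathlib.Analysis.Convex.SpecificFunctions.Basic
import HarnessLib

/-!
# Crux `UVSeamRec` (stmt-QuantumFields-20043), v5(α) stub `stub_responseMomentsOdd6` (RM): the SEPARATION SCALE IS IMMATERIAL —
# (RM) for `m(2R+4)`-separated families implies (RM) for `2R+4`-separated families with `C₁ ↦ (4m+4)⁴·C₁`

Helper file (`--supports stmt-QuantumFields-20043`) of the stub-helper seat `ym-20043-seam-s2` (lane S-A, gen 2); sequel of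
`…SeparatedFamilyColouring.lean` (the colouring) and `…ResponseMomentsNormalForms.lean` (p545554, the other normal forms).

The registered binder asks the joint exponential response moments for families whose radius-`R+1` cubes are pairwise cyclically
`2R+4`-separated in some coordinate — i.e. the cubes may TOUCH (gap one lattice unit).  A prover's engine (cluster expansion,
decoupling at scale `R`) is far more comfortable with cubes a fixed multiple of `R` apart.  This file shows the two are the same
statement up to the constant `C₁` (which the binder quantifies existentially):

  **`responseMoments_of_sparse`**: if for `β ≥ β₁`, on every odd torus (`4R+8 ≤ L`, `1 ≤ R`, `R·a β ≤ ℓ₁`), for every family that is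
  pairwise cyclically `m(2R+4)`-SEPARATED in some coordinate and every `T`, `⟨exp(Σ_{i∈T}(R⁴/C₁)|kerE_i − p_i|)⟩ ≤ e^{B·#T}`, then the
  same holds for every `2R+4`-separated family with `C₁` replaced by `(4m+4)⁴·C₁` (same `B`, `β₁`, `ℓ₁`, `p`).

Mechanism: colour the family coordinatewise by the arc colouring of `…SeparatedFamilyColouring` (at most `K = (4m+4)⁴`
classes, members of one class `m(2R+4)`-separated, `Sparse.sparse_of_colour_eq`); split the exponent over the classes; AM–GM / convexity of `exp`:
`exp((1/K)Σ_κ S_κ) ≤ (1/K')Σ_κ exp(S_κ)` over the `K' ≤ K` occupied classes; apply the sparse hypothesis class by class (each class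
reindexed as a family of its own); `B ≥ 0` is forced by a singleton.  The trick does NOT transfer to the product currencies
(PM)/(PM₂) (Hölder/AM–GM would need `K`-th powers) — a structural advantage of (RM) worth recording for the v6 choice.
Also: `torusE_finset_sum` (toolkit).

HONEST FRAMING: a normal form of an OPEN binder of a CONDITIONAL chain; nothing of E0′; not a gap, not Clay.

References: convexity of `exp` (Mathlib `convexOn_exp`, `ConvexOn.map_sum_le`).
-/

set_option autoImplicit false

noncomputable section

open MeasureTheory Filter Topology Finset
open Literature.MathematicalPhysics.QuantumFieldTheory (GaugeConfig wilsonMeasure isProbabilityMeasure_wilsonMeasure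
  LatticeRep)
open Literature.MathematicalPhysics.QuantumLattice
open Literature.Probability.LatticeModels
open Summit.QuantumFields.YangMills.Cruxes.OSLegsFromFemtoAndGap.DlrCollarTransfer
open Summit.QuantumFields.YangMills.Cruxes.UVSeamRec.TemperedResponse (continuous_kerE_plane)

namespace Summit.QuantumFields.YangMills.Cruxes.UVSeamRec.ResponsePinning

variable {G : Type} [Group G] [TopologicalSpace G] [IsTopologicalGroup G] [CompactSpace G]
  [MeasurableSpace G] [BorelSpace G] (r : LatticeRep G) (a : ℝ → ℝ)

/-- Torus expectation of a finite sum of continuous observables. [folklore] -/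
theorem torusE_finset_sum (β : ℝ) (L : ℕ) {ι : Type*} (C : Finset ι) (F : ι → LGConfig 4 G → ℝ)
    (hF : ∀ κ ∈ C, Continuous (F κ)) :
    torusE G r β L (fun U => ∑ κ ∈ C, F κ U) = ∑ κ ∈ C, torusE G r β L (F κ) := by
  unfold torusE
  rw [← integral_finsetSum C (fun κ hκ => integrable_comp_lift r β L (hF κ hκ))]

/-- **The separation scale is immaterial for (RM).**  See the module docstring: (RM) for families pairwise cyclically
`m(2R+4)`-separated in some coordinate [`C₁`, `B`, `β₁`, `ℓ₁`, `p`] ⇒ (RM) for `2R+4`-separated families [`(4m+4)⁴·C₁`, `B`, `β₁`,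
`ℓ₁`, `p`] — the `hRM` of p532025 / the body of the registered binder. [folklore] -/
theorem responseMoments_of_sparse (m : ℕ) {C₁ B β₁ ℓ₁ : ℝ} {p : Fin 4 × Fin 4 → ℝ → ℝ} (hC₁ : 0 < C₁)
    (hS : ∀ β : ℝ, β₁ ≤ β → ∀ (L n : ℕ) (q : Fin n → Fin 4 × Fin 4) (x : Fin n → (Fin 4 → ℤ)) (R : ℕ),
      (∀ i, (q i).1 < (q i).2) → 1 ≤ R → (R : ℝ) * a β ≤ ℓ₁ → 4 * R + 8 ≤ L →
      (∀ i j : Fin n, i ≠ j → ∃ k : Fin 4,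
        ((m * (2 * R + 4) : ℕ) : ℤ) ≤ |((((x i k - x j k : ℤ) : ZMod (2 * L + 1))).valMinAbs : ℤ)|) →
      ∀ T : Finset (Fin n),
        torusE G r β L (fun U => Real.exp (∑ i ∈ T, (R : ℝ) ^ 4 / C₁ *
          |kerE G r β (fun k => x i k - (R + 1)) (2 * R + 3) U (plane G r (q i) (x i)) - p (q i) β|)) ≤
          Real.exp (B * T.card)) :
    ∀ β : ℝ, β₁ ≤ β → ∀ (L n : ℕ) (q : Fin n → Fin 4 × Fin 4) (x : Fin n → (Fin 4 → ℤ)) (R : ℕ),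
      (∀ i, (q i).1 < (q i).2) → 1 ≤ R → (R : ℝ) * a β ≤ ℓ₁ → 4 * R + 8 ≤ L →
      (∀ i j : Fin n, i ≠ j → ∃ k : Fin 4,
        (2 * (R : ℤ) + 4) ≤ |((((x i k - x j k : ℤ) : ZMod (2 * L + 1))).valMinAbs : ℤ)|) →
      ∀ T : Finset (Fin n),
        torusE G r β L (fun U => Real.exp (∑ i ∈ T, (R : ℝ) ^ 4 / ((((4 * m + 4) ^ 4 : ℕ) : ℝ) * C₁) *
          |kerE G r β (fun k => x i k - (R + 1)) (2 * R + 3) U (plane G r (q i) (x i)) - p (q i) β|)) ≤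
          Real.exp (B * T.card) := by
  classical
  intro β hβ L n q x R hq hR hRa hRL hsep T
  haveI : NeZero (2 * L + 1) := ⟨by omega⟩
  -- notation
  set y : Fin n → LGConfig 4 G → ℝ := fun i U => (R : ℝ) ^ 4 / C₁ *
    |kerE G r β (fun k => x i k - (R + 1)) (2 * R + 3) U (plane G r (q i) (x i)) - p (q i) β| with hy
  have hy0 : ∀ i U, 0 ≤ y i U := fun i U => by positivity
  have hyc : ∀ i, Continuous (y i) := fun i =>
    continuous_const.mul ((continuous_kerE_plane r β _ _ (q i) (x i)).sub continuous_const).abs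
  set K₀ : ℕ := (4 * m + 4) ^ 4 with hK₀
  have hK₀pos : (0 : ℝ) < (K₀ : ℝ) := by positivity
  -- the target integrand is `exp((1/K₀) Σ_{i∈T} y i)`
  have htarget : (fun U : LGConfig 4 G => Real.exp (∑ i ∈ T, (R : ℝ) ^ 4 / ((K₀ : ℝ) * C₁) *
      |kerE G r β (fun k => x i k - (R + 1)) (2 * R + 3) U (plane G r (q i) (x i)) - p (q i) β|)) =
      fun U => Real.exp ((1 / (K₀ : ℝ)) * ∑ i ∈ T, y i U) := by
    funext U; congr 1; rw [Finset.mul_sum]; refine Finset.sum_congr rfl fun i _ => ?_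
    simp only [hy]; field_simp
  rw [htarget]
  -- the empty family
  rcases T.eq_empty_or_nonempty with hT | ⟨i₀, hi₀⟩
  · subst hT
    simp only [Finset.sum_empty, mul_zero, Real.exp_zero, Finset.card_empty, Nat.cast_zero]
    exact (torusE_const r β L 1).le
  -- `B ≥ 0`, from the singleton family `{i₀}`
  have hB : 0 ≤ B := by
    have h1 := hS β hβ L 1 (fun _ => q i₀) (fun _ => x i₀) R (fun _ => hq i₀) hR hRa hRL
      (fun i j hij => absurd (Subsingleton.elim i j) hij) Finset.univ
    simp only [Finset.univ_unique, Finset.sum_singleton, Finset.card_singleton, Nat.cast_one, mul_one] at h1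
    have h2 : (1 : ℝ) ≤ torusE G r β L (fun U => Real.exp (y i₀ U)) := by
      calc (1 : ℝ) = torusE G r β L (fun _ => 1) := (torusE_const r β L 1).symm
        _ ≤ _ := torusE_mono r β L continuous_const (Real.continuous_exp.comp (hyc i₀)) fun U =>
            Real.one_le_exp (hy0 i₀ U)
    by_contra hB
    have : Real.exp B < 1 := Real.exp_lt_one_iff.2 (not_le.mp hB)
    linarith [h2.trans h1]
  -- the colouring and its classes (arc count `Mₐ = ⌈N/s⌉`, arc index `⌊val·Mₐ/N⌋`, cyclic colouring with period `2m+2`)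
  set s : ℕ := 2 * R + 4 with hs
  have hs1 : 1 ≤ s := by omega
  have hsN : s ≤ 2 * L + 1 := by omega
  obtain ⟨Mₐ, hMₐ⟩ : ∃ M : ℕ, M = (2 * L + 1 + s - 1) / s := ⟨_, rfl⟩
  obtain ⟨c, hc⟩ : ∃ c : ℕ → ℕ, ∀ j, c j = if j < Mₐ - Mₐ % (2 * m + 2) then j % (2 * m + 2)
      else (2 * m + 2) + (j - (Mₐ - Mₐ % (2 * m + 2))) := ⟨_, fun j => rfl⟩
  obtain ⟨col, hcol⟩ : ∃ col : Fin n → (Fin 4 → ℕ),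
      ∀ i k, col i k = c ((((x i k : ℤ) : ZMod (2 * L + 1))).val * Mₐ / (2 * L + 1)) := ⟨_, fun i k => rfl⟩
  set C : Finset (Fin 4 → ℕ) := T.image col with hC
  have hCne : C.Nonempty := ⟨col i₀, Finset.mem_image_of_mem col hi₀⟩
  have hK'pos : (0 : ℝ) < (C.card : ℝ) := by exact_mod_cast Finset.card_pos.2 hCne
  -- at most `K₀` classes
  have hCK : C.card ≤ K₀ := by
    have hsub : C ⊆ Fintype.piFinset fun _ : Fin 4 => Finset.range (4 * m + 4) := by
      intro κ hκ
      obtain ⟨i, _, rfl⟩ := Finset.mem_image.1 hκ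
      refine Fintype.mem_piFinset.2 fun k => Finset.mem_range.2 ?_
      have h := Sparse.arcColour_lt c hc (by omega)
        (Sparse.arcIdx_lt hs1 hMₐ (ZMod.val_lt (((x i k : ℤ) : ZMod (2 * L + 1)))))
      rw [hcol]
      omega
    calc C.card ≤ (Fintype.piFinset fun _ : Fin 4 => Finset.range (4 * m + 4)).card := Finset.card_le_card hsub
      _ = K₀ := by rw [Fintype.card_piFinset]; simp [hK₀, Finset.card_range, Finset.prod_const]
  -- members of one class are `m·s`-separated
  have hsparse : ∀ i j : Fin n, i ≠ j → col i = col j → ∃ k : Fin 4,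
      ((m * (2 * R + 4) : ℕ) : ℤ) ≤ |((((x i k - x j k : ℤ) : ZMod (2 * L + 1))).valMinAbs : ℤ)| := by
    intro i j hij hcij
    obtain ⟨k, hk⟩ := hsep i j hij
    have hk' : (s : ℤ) ≤ |((((x i k - x j k : ℤ) : ZMod (2 * L + 1))).valMinAbs : ℤ)| := by
      rw [hs]; exact_mod_cast hk
    refine Sparse.sparse_of_colour_eq hs1 hsN hMₐ c hc ⟨k, hk'⟩ fun k => ?_
    rw [← hcol, ← hcol, hcij]
  -- class sums and the class-by-class bound
  set S : (Fin 4 → ℕ) → LGConfig 4 G → ℝ := fun κ U => ∑ i ∈ T.filter (fun i => col i = κ), y i U with hSdef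
  have hSc : ∀ κ, Continuous (S κ) := fun κ => continuous_finsetSum _ fun i _ => hyc i
  have hS0 : ∀ κ U, 0 ≤ S κ U := fun κ U => Finset.sum_nonneg fun i _ => hy0 i U
  have hclass : ∀ κ ∈ C, torusE G r β L (fun U => Real.exp (S κ U)) ≤ Real.exp (B * T.card) := by
    intro κ _
    set Tκ := T.filter (fun i => col i = κ) with hTκ
    -- reindex the class as a family of its own and apply the sparse hypothesis with `T' = univ`
    have hsepκ : ∀ i' j' : Fin Tκ.card, i' ≠ j' → ∃ k : Fin 4, ((m * (2 * R + 4) : ℕ) : ℤ) ≤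
        |((((x ((Tκ.equivFin.symm i' : Tκ) : Fin n) k - x ((Tκ.equivFin.symm j' : Tκ) : Fin n) k : ℤ) :
          ZMod (2 * L + 1))).valMinAbs : ℤ)| := by
      intro i' j' hij
      have hne : ((Tκ.equivFin.symm i' : Tκ) : Fin n) ≠ ((Tκ.equivFin.symm j' : Tκ) : Fin n) := fun h =>
        hij (Tκ.equivFin.symm.injective (Subtype.ext h))
      have hi := Finset.mem_filter.1 (Tκ.equivFin.symm i').2
      have hj := Finset.mem_filter.1 (Tκ.equivFin.symm j').2
      exact hsparse _ _ hne (hi.2.trans hj.2.symm)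
    have h := hS β hβ L Tκ.card (fun i' => q ((Tκ.equivFin.symm i' : Tκ) : Fin n))
      (fun i' => x ((Tκ.equivFin.symm i' : Tκ) : Fin n)) R (fun i' => hq _) hR hRa hRL hsepκ Finset.univ
    rw [Finset.card_univ, Fintype.card_fin] at h
    have e1 : (fun U : LGConfig 4 G => Real.exp (S κ U)) =
        fun U => Real.exp (∑ i' : Fin Tκ.card, y ((Tκ.equivFin.symm i' : Tκ) : Fin n) U) := by
      funext U
      rw [hSdef]
      simp only
      rw [Equiv.sum_comp Tκ.equivFin.symm (fun t : Tκ => y (t : Fin n) U), Finset.sum_coe_sort Tκ (fun i => y i U)]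
    rw [e1]
    refine h.trans (Real.exp_le_exp.2 ?_)
    exact mul_le_mul_of_nonneg_left (by exact_mod_cast Finset.card_filter_le T _) hB
  -- pointwise: split over classes, then convexity of `exp`
  have hsplit : ∀ U, ∑ i ∈ T, y i U = ∑ κ ∈ C, S κ U := fun U =>
    (Finset.sum_fiberwise_of_maps_to (fun i hi => Finset.mem_image_of_mem col hi) (fun i => y i U)).symm
  have hpt : ∀ U, Real.exp ((1 / (K₀ : ℝ)) * ∑ i ∈ T, y i U) ≤
      ∑ κ ∈ C, (1 / (C.card : ℝ)) * Real.exp (S κ U) := by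
    intro U
    have hsum0 : 0 ≤ ∑ κ ∈ C, S κ U := Finset.sum_nonneg fun κ _ => hS0 κ U
    calc Real.exp ((1 / (K₀ : ℝ)) * ∑ i ∈ T, y i U)
        ≤ Real.exp ((1 / (C.card : ℝ)) * ∑ κ ∈ C, S κ U) := by
          rw [hsplit U]
          refine Real.exp_le_exp.2 (mul_le_mul_of_nonneg_right ?_ hsum0)
          exact one_div_le_one_div_of_le hK'pos (by exact_mod_cast hCK)
      _ = Real.exp (∑ κ ∈ C, (1 / (C.card : ℝ)) • S κ U) := by rw [Finset.mul_sum]; rfl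
      _ ≤ ∑ κ ∈ C, (1 / (C.card : ℝ)) • Real.exp (S κ U) := by
          refine convexOn_exp.map_sum_le (fun κ _ => by positivity) ?_ (fun κ _ => Set.mem_univ _)
          rw [Finset.sum_const, nsmul_eq_mul, mul_one_div, div_self (ne_of_gt hK'pos)]
      _ = ∑ κ ∈ C, (1 / (C.card : ℝ)) * Real.exp (S κ U) := rfl
  -- integrate
  calc torusE G r β L (fun U => Real.exp ((1 / (K₀ : ℝ)) * ∑ i ∈ T, y i U))
      ≤ torusE G r β L (fun U => ∑ κ ∈ C, (1 / (C.card : ℝ)) * Real.exp (S κ U)) :=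
        torusE_mono r β L (Real.continuous_exp.comp (continuous_const.mul (continuous_finsetSum _ fun i _ => hyc i)))
          (continuous_finsetSum _ fun κ _ => continuous_const.mul (Real.continuous_exp.comp (hSc κ))) hpt
    _ = ∑ κ ∈ C, (1 / (C.card : ℝ)) * torusE G r β L (fun U => Real.exp (S κ U)) := by
        rw [torusE_finset_sum r β L C (fun κ U => (1 / (C.card : ℝ)) * Real.exp (S κ U))
          (fun κ _ => continuous_const.mul (Real.continuous_exp.comp (hSc κ)))]
        exact Finset.sum_congr rfl fun κ _ => torusE_const_mul' r β L _ _
    _ ≤ ∑ κ ∈ C, (1 / (C.card : ℝ)) * Real.exp (B * T.card) :=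
        Finset.sum_le_sum fun κ hκ => mul_le_mul_of_nonneg_left (hclass κ hκ) (by positivity)
    _ = Real.exp (B * T.card) := by
        rw [Finset.sum_const, nsmul_eq_mul, ← mul_assoc, mul_one_div, div_self (ne_of_gt hK'pos), one_mul]

end Summit.QuantumFields.YangMills.Cruxes.UVSeamRec.ResponsePinning

end
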